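import Literature.Topology.FourManifolds.TrisectionsMiddleRegion
import Literature.Topology.FourManifolds.TrisectionsBevelledSector
import Literature.Topology.FourManifolds.CreaseProfile
import Mathlib.Analysis.Calculus.Deriv.Slope
import HarnessLib

/-!
# The middle sectors `X₂`, `X₃` of the trisection from a handle decomposition: definitions,
# the cover `X = X₁ ∪ X₂ ∪ X₃`, and their wedges and corner charts along `F` (Gay–Kirby 2016, Lemma 14)

Topic `Literature/Topology/FourManifolds`; infrastructure for the fact seat
`provefact-Literature.Topology.FourManifolds.exists_isBalancedGKTrisection` (Gay–Kirby 2016,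
Thm. 4 via Lemma 14).  Everything in this file is **proved**; no named facts are introduced.

Gay–Kirby, proof of Lemma 14: *"Consider the Heegaard splitting `F ⊂ ∂X₁`, giving
`∂X₁ = H₁₂ ∪_F H₃₁`, and flow `F` along `∇f`.  Assuming `L ⊂ H₁₂`, we define `X₂` to be the
union of `[0, ε] × H₁₂` (the collar) and the `2`-handles.  Then `X₂ ∩ X₁ = H₁₂` and
`X₂ ∩ ([1 + ε] × ∂X₁ ∪ 2-handles) = H₂₃ …"* — the rest, above, is `X₃ ⊇ X₃⁰ = {f ≥ 5/2}`.
With the bevelled first sector `X₁` of `TrisectionsBevelledSector.lean` and the landing map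
`λ` and transported Heegaard coordinate `G = g ∘ λ - b` of `TrisectionsMiddleRegion.lean`
(`BiCollar.gFun`), the two remaining sectors are, formally:

* `X₂ = closure {x ∉ X₁ | f x < c, x hits ∂X₁⁰ = f⁻¹(a), M x < 0} ∪ sheets` — essentially the
  points outside `X₁` and below the top level `c` which land in the open handlebody
  `{g < b} = int H₁₂`, closed up (the closure adds the sheet `{G = 0}` swept out by `F` and the
  part of `∂X₁` over `H₁₂`), together with the *ascending sheets*
  `{a ≤ f ≤ c, the trajectory does not hit}` of the index-`2` critical points — the cores of
  the `2`-handles; here `M = G + σ_ε((f - c) - G)` (`TriData.M`) is the smooth rounding of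
  `max(G, f - c)` by the crease profile of `CreaseProfile.lean`: the sectors of a trisection
  may have corners only along `F` (Gay–Kirby, Def. 1), so the crease where the sheet `{G = 0}`
  meets the top level `{f = c}` has to be rounded, and `{M = 0}` does it;
* `X₃ = closure {x ∉ X₁ | x hits, M x > 0} ∪ {f ≥ c}`.

This file introduces the data (`BiCollar.TriData`: a Morse frame, bevel data, the top level
`c`, the rounding width `ε`) and proves:

* the **cover** `X = X₁ ∪ X₂ ∪ X₃` (`TriData.mem_X₁_or_mem_X₂_or_mem_X₃`, `iUnion_eq_univ` —
  clause (i) of `Literature.Topology.FourManifolds.IsGKTrisection`): a point outside `X₁` and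
  below `c` either hits the level — and then lies in `X₂`, `X₃` or, if `M = 0`, in the closure
  of both (`mem_closure_S₂_of_M_eq_zero`: if `w = (f - c) - G > -ε` flow the point backwards,
  `σ_ε` being strictly increasing on `[-ε, ∞)`; if `w ≤ -ε` the point lands on `F` and one
  moves the landing point off `F` with the flow of `V` inside `∂X₁⁰` and flows back up,
  `BiCollar.slide`, along which `M` has derivative `∓1`) — or does not, and then it lies on an
  ascending sheet since points outside `X₁` which do not hit have `f ≥ a`
  (`a_le_of_not_mem_X₁_of_not_hit`: below the level, outside `X₁` means inside the bevel,
  inside the band of `U`, whose points hit);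
* the **wedge description near `F`**: on the bi-collar box of radius `ε_w` (where the bumps
  of the bevel are `1`, so that `X₁ = {s + κ|r| ≤ 0}`, and where `M = G = r` — no rounding takes
  place there since `ε ≤ c - a - 2ε_w`),
  `X₂ = {r ≤ 0, s - κ r ≥ 0}` and `X₃ = {r ≥ 0, s + κ r ≥ 0}` (`mem_X₂_iff_of_mem_box`,
  `mem_X₃_iff_of_mem_box`; `⊆` by continuity from the generic parts, `⊇` by perturbing into the
  generic parts with the bi-collar parametrisation `Ψ`), i.e. the wedges of the frames
  `frame₂ = (1, -κ; 0, -1)`, `frame₃ = (1, κ; 0, 1)` — Gay–Kirby's Fig. 1: three convex sectors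
  of the `(s, r)`-plane around `F`;
* hence **the corner-slice charts of `X₂` and `X₃` along `F`** (`cornerSliceChart₂`,
  `cornerSliceChart₃`, from `BiCollar.cornerSliceChart`), the input of the corner clause of
  `IsGKTrisection` for these sectors, and `F ⊆ X₂ ∩ X₃`;
* **the `λ`-lemma** `eventually_gFun_neg_of_mem_sheets`: if the descending sets of the
  critical points `q` with `a < f q ≤ c` meet `∂X₁⁰` inside `{g < b}` (Gay–Kirby: "assuming
  `L ⊂ H₁₂`"), then near the ascending sheets the points which hit land in `{g < b}`; hence the
  sheets below `c` are interior to `X₂` and away from `X₃` (`X₂_mem_nhds_of_mem_sheets`: the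
  `2`-handles lie inside `X₂`; with the threshold `b - η`, `η > ε`, to absorb the rounding).
  The proof is soft: a cluster point of landing points of points
  accumulating at the sheet flows forward to a critical point, which cannot lie above `c`
  (else the accumulating points would lie on the compact flow-out of the level for a bounded
  set of times, a closed set of points which hit), so lies in `(a, c]`, and the cluster point
  is on its descending set.

## References

* D. Gay, R. Kirby, *Trisecting 4-manifolds*, Geom. Topol. 20 (2016) 3097–3132
  (arXiv:1205.1565): §4, Lemma 14 and its proof. [GayKirby2016]
* J. Milnor, *Lectures on the h-cobordism theorem* (1965), Def. 3.9, Thm. 4.1 and its proof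
  (PDF p. 22). [MilnorHCobordism1965]
-/

open scoped Manifold ContDiff Topology
open Set Function Filter

noncomputable section

universe u

namespace Literature.Topology.FourManifolds

variable {X : Type u} [TopologicalSpace X] [T2Space X] [CompactSpace X]
  [ChartedSpace (EuclideanSpace ℝ (Fin 4)) X] [IsManifold (𝓡 4) ∞ X]

namespace BiCollar

variable (B : BiCollar X)

/-- **Trisection data over a bi-collar**: a Morse frame (`f` Morse, `U.ξ` gradient-like), bevel
data for the first sector, a top level `c` above the band of `U` carrying no critical point,
and the width `ε` of the rounding of the crease where the sheet over `F` meets the top level.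
[cite: GayKirby2016, §4, Lemma 14] -/
structure TriData where
  /-- `f` is Morse and `U.ξ` is gradient-like. -/
  Fr : B.MorseFrame
  /-- The bevel of the first sector. -/
  D : B.BevelData
  /-- The top level (`5/2` in Lemma 14). -/
  c : ℝ
  /-- The band of `U` lies below the top level. -/
  band_le_c : B.a + B.U.δ ≤ c
  /-- No critical point lies on the top level. -/
  regular_c : ∀ x, B.f x = c → ¬ IsMCriticalPt (𝓡 4) B.f x
  /-- The width of the rounding of the crease between the sheet over `F` and the top level. -/
  ε : ℝ
  /-- The width is positive. -/
  ε_pos : 0 < ε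
  /-- The width is small: on the bi-collar box of radius `ε_w` no rounding takes place. -/
  ε_le : ε ≤ c - B.a - 2 * D.εw

/-- A point of the level hits it. [folklore] -/
theorem hit_of_apply_eq {y : X} (hy : B.f y = B.a) : B.Hit y :=
  ⟨0, by show B.f (B.U.fl y 0) = B.a; rw [B.U.fl_zero]; exact hy⟩

/-- The curve used to approximate a point `x` landing on `F` by points landing off `F`: move
the landing point by the flow of `V` inside the level for time `t` and flow back up for the
time `τ` it takes from `λ x` to `x`. [cite: GayKirby2016, §4, Lemma 14] -/
def slide (x : X) (τ t : ℝ) : X :=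
  B.U.fl (RegularLevel.incl B.hf (B.V.fl (B.lamLift x) t)) τ

/-- The slide is continuous in `t`. [folklore] -/
theorem continuous_slide (x : X) (τ : ℝ) : Continuous fun t => B.slide x τ t := by
  unfold slide
  refine B.U.continuous_fl.comp (Continuous.prodMk ?_ continuous_const)
  exact (RegularLevel.isEmbedding_incl B.hf).continuous.comp
    (B.V.continuous_fl.comp (continuous_const.prodMk continuous_id))

/-- At `t = 0` the slide through the time `τ` with `U.fl (λ x) τ = x` is `x`. [folklore] -/
theorem slide_zero {x : X} (hx : B.Hit x) {τ : ℝ} (hτ : B.U.fl (B.lam x) τ = x) : B.slide x τ 0 = x := by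
  unfold slide
  rw [B.V.fl_zero, B.incl_lamLift hx, hτ]

/-- The slid points hit the level. [folklore] -/
theorem hit_slide (x : X) (τ t : ℝ) : B.Hit (B.slide x τ t) :=
  B.hit_fl (B.hit_of_apply_eq (RegularLevel.apply_incl B.hf _)) τ

variable {B} in
/-- The landing point of a slid point. [folklore] -/
theorem MorseFrame.lamLift_slide (Fr : B.MorseFrame) (x : X) (τ t : ℝ) :
    B.lamLift (B.slide x τ t) = B.V.fl (B.lamLift x) t := by
  apply (RegularLevel.isEmbedding_incl B.hf).injective
  have h0 : B.Hit (RegularLevel.incl B.hf (B.V.fl (B.lamLift x) t)) :=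
    B.hit_of_apply_eq (RegularLevel.apply_incl B.hf _)
  rw [B.incl_lamLift (B.hit_slide x τ t), slide, Fr.lam_fl h0 τ,
    Fr.lam_of_apply_eq (RegularLevel.apply_incl B.hf _)]

variable {B} in
/-- The transported Heegaard coordinate of a slid point, when `x` lands on `F` (`G x = 0`) and
`|t| < δ_V`: `G = t` (the clock of `V`). [cite: GayKirby2016, §4, Lemma 14] -/
theorem MorseFrame.gFun_slide (Fr : B.MorseFrame) {x : X} (h0 : B.gFun x = 0) (τ : ℝ) {t : ℝ}
    (ht : t ∈ Ioo (-B.V.δ) B.V.δ) : B.gFun (B.slide x τ t) = t := by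
  have hg : B.g (B.lamLift x) = B.b := by
    have h : B.g (B.lamLift x) - B.b = 0 := h0
    linarith
  rw [BiCollar.gFun, Fr.lamLift_slide, B.V.apply_fl_eq_add (B.V.mem_band_of_apply_eq hg)
    (by rw [hg]; exact ⟨by linarith [ht.1], by linarith [ht.2]⟩), hg]
  ring

variable {B} in
/-- A point which hits the level is not critical (critical points are fixed by the flow and
do not lie on the level). [folklore] -/
theorem MorseFrame.not_isMCriticalPt_of_hit (Fr : B.MorseFrame) {x : X} (hx : B.Hit x) :
    ¬ IsMCriticalPt (𝓡 4) B.f x := fun h => by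
  obtain ⟨t, ht⟩ := hx
  have ht' : B.f (B.U.fl x t) = B.a := ht
  have hfix : B.U.fl x t = x := IsGradientLike.flow_eq_self Fr.isGradientLike B.U.contMDiff h t
  rw [hfix] at ht'
  exact B.not_isMCriticalPt_of_apply_eq_a ht' h

variable {B} in
/-- `f` decreases strictly backwards along the trajectory of a point which hits. [cite: MilnorHCobordism1965, Def. 3.1] -/
theorem MorseFrame.f_fl_lt_of_pos (Fr : B.MorseFrame) {x : X} (hx : B.Hit x) {t : ℝ} (ht : 0 < t) :
    B.f (B.U.fl x (-t)) < B.f x := by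
  have h := IsGradientLike.strictMono_comp_flow Fr.isGradientLike Fr.isMorse B.U.contMDiff
    (Fr.not_isMCriticalPt_of_hit hx) (show -t < 0 by linarith)
  have h0 : B.f (B.U.fl x 0) = B.f x := by rw [B.U.fl_zero]
  rw [← h0]
  exact h

variable {B} in
/-- `f` increases strictly forwards along the trajectory of a point which hits. [cite: MilnorHCobordism1965, Def. 3.1] -/
theorem MorseFrame.lt_f_fl_of_pos (Fr : B.MorseFrame) {x : X} (hx : B.Hit x) {t : ℝ} (ht : 0 < t) :
    B.f x < B.f (B.U.fl x t) := by
  have h := IsGradientLike.strictMono_comp_flow Fr.isGradientLike Fr.isMorse B.U.contMDiff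
    (Fr.not_isMCriticalPt_of_hit hx) ht
  have h0 : B.f (B.U.fl x 0) = B.f x := by rw [B.U.fl_zero]
  rw [← h0]
  exact h

/-- The backward flow of a point tends to the point as the time tends to `0⁺`. [folklore] -/
theorem tendsto_fl_neg (x : X) : Tendsto (fun t : ℝ => B.U.fl x (-t)) (𝓝[>] (0 : ℝ)) (𝓝 x) := by
  have hc : Continuous fun t : ℝ => B.U.fl x (-t) := B.U.continuous_fl.comp (continuous_const.prodMk continuous_neg)
  have h := hc.continuousAt (x := (0 : ℝ))
  rw [ContinuousAt] at h
  simp only [neg_zero, B.U.fl_zero] at h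
  exact h.mono_left nhdsWithin_le_nhds

/-- The forward flow of a point tends to the point as the time tends to `0⁺`. [folklore] -/
theorem tendsto_fl (x : X) : Tendsto (fun t : ℝ => B.U.fl x t) (𝓝[>] (0 : ℝ)) (𝓝 x) := by
  have hc : Continuous fun t : ℝ => B.U.fl x t := B.U.continuous_fl.comp (continuous_const.prodMk continuous_id)
  have h := hc.continuousAt (x := (0 : ℝ))
  rw [ContinuousAt] at h
  simp only [B.U.fl_zero] at h
  exact h.mono_left nhdsWithin_le_nhds

/-- The slide is smooth in its time parameter, so `t ↦ f (slide x τ t)` is differentiable.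
[folklore] -/
theorem hasDerivAt_f_slide (x : X) (τ t : ℝ) :
    HasDerivAt (fun t => B.f (B.slide x τ t)) (deriv (fun t => B.f (B.slide x τ t)) t) t := by
  have h1 : ContMDiff 𝓘(ℝ, ℝ) (𝓡 3) ∞ fun t : ℝ => B.V.fl (B.lamLift x) t :=
    B.V.contMDiff_fl.comp (contMDiff_const.prodMk contMDiff_id)
  have h2 : ContMDiff 𝓘(ℝ, ℝ) (𝓡 4) ∞ fun t : ℝ => B.slide x τ t := by
    unfold BiCollar.slide
    exact B.U.contMDiff_fl.comp (((RegularLevel.contMDiff_incl B.hf).comp h1).prodMk contMDiff_const)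
  have h3 : ContDiff ℝ ∞ fun t : ℝ => B.f (B.slide x τ t) :=
    contMDiff_iff_contDiff.1 (B.U.contMDiff_f.comp h2)
  exact ((h3.differentiable (by simp)) t).hasDerivAt

omit [T2Space X] [CompactSpace X] [ChartedSpace (EuclideanSpace ℝ (Fin 4)) X] [IsManifold (𝓡 4) ∞ X] in
/-- From a derivative `-1` at `0` and the value `0` at `0`: negative just to the right. [folklore] -/
theorem _root_.Literature.Topology.FourManifolds.eventually_neg_of_hasDerivAt {φ : ℝ → ℝ}
    (hφ : HasDerivAt φ (-1) 0) (h0 : φ 0 = 0) : ∀ᶠ t in 𝓝[>] (0 : ℝ), φ t < 0 := by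
  rw [hasDerivAt_iff_tendsto_slope_zero] at hφ
  have h := (hφ.mono_left (nhdsWithin_mono _ (fun t (ht : t ∈ Ioi (0 : ℝ)) => ne_of_gt ht))).eventually
    (Iio_mem_nhds (by norm_num : (-1 : ℝ) < 0))
  filter_upwards [h, self_mem_nhdsWithin] with t ht ht0
  have ht0 : 0 < t := ht0
  rw [zero_add, h0, sub_zero, smul_eq_mul] at ht
  by_contra hcon
  have : 0 ≤ t⁻¹ * φ t := mul_nonneg (inv_nonneg.2 ht0.le) (not_lt.1 hcon)
  linarith

omit [T2Space X] [CompactSpace X] [ChartedSpace (EuclideanSpace ℝ (Fin 4)) X] [IsManifold (𝓡 4) ∞ X] in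
/-- From a derivative `1` at `0` and the value `0` at `0`: positive just to the right. [folklore] -/
theorem _root_.Literature.Topology.FourManifolds.eventually_pos_of_hasDerivAt {φ : ℝ → ℝ}
    (hφ : HasDerivAt φ 1 0) (h0 : φ 0 = 0) : ∀ᶠ t in 𝓝[>] (0 : ℝ), 0 < φ t := by
  rw [hasDerivAt_iff_tendsto_slope_zero] at hφ
  have h := (hφ.mono_left (nhdsWithin_mono _ (fun t (ht : t ∈ Ioi (0 : ℝ)) => ne_of_gt ht))).eventually
    (Ioi_mem_nhds (by norm_num : (0 : ℝ) < 1))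
  filter_upwards [h, self_mem_nhdsWithin] with t ht ht0
  have ht0 : 0 < t := ht0
  rw [zero_add, h0, sub_zero, smul_eq_mul] at ht
  by_contra hcon
  have : t⁻¹ * φ t ≤ 0 := mul_nonpos_iff.2 (Or.inl ⟨inv_nonneg.2 ht0.le, not_lt.1 hcon⟩)
  linarith

namespace TriData

variable {B} (T : B.TriData)

/-- The first sector `X₁` (bevelled sublevel set). [cite: GayKirby2016, §4, Lemma 14] -/
def X₁ : Set X := T.D.sector

/-- The crease coordinate `w = (f - c) - G`. [folklore] -/
def w (x : X) : ℝ := B.f x - T.c - B.gFun x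

/-- **The rounded dividing function** `M = G + σ_ε(w)`, the smooth rounding of `max(G, f - c)`
(`Literature.Topology.FourManifolds.creaseσ`): it is `G` where `f - c ≤ G - ε` (in particular
near the level `f = a`) and `f - c` where `f - c ≥ G + ε` (in particular near the tops of the
ascending sheets), so that the dividing hypersurface `{M = 0}` between `X₂` and `X₃` is the
sheet `{G = 0}` over `F` low down, the top level `{f = c}` over `{G ≤ -ε}`, and a smooth
rounding of the crease in between. [cite: GayKirby2016, §4, Lemma 14; Douady1961, §6] -/
def M (x : X) : ℝ := B.gFun x + creaseσ T.ε (T.w x)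

/-- `max(G, f - c) ≤ M`. [folklore] -/
theorem max_le_M (x : X) : max (B.gFun x) (B.f x - T.c) ≤ T.M x := by
  have h := max_le_creaseσ T.ε_pos (T.w x)
  have h1 : T.w x ≤ creaseσ T.ε (T.w x) := (le_max_left _ _).trans h
  have h2 : 0 ≤ creaseσ T.ε (T.w x) := (le_max_right _ _).trans h
  have hw : T.w x = B.f x - T.c - B.gFun x := rfl
  show max (B.gFun x) (B.f x - T.c) ≤ B.gFun x + creaseσ T.ε (T.w x)
  exact max_le (by linarith) (by linarith)

/-- `M ≤ max(G, f - c) + ε`. [folklore] -/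
theorem M_le (x : X) : T.M x ≤ max (B.gFun x) (B.f x - T.c) + T.ε := by
  have h := creaseσ_le T.ε_pos (T.w x)
  have hw' : T.w x = B.f x - T.c - B.gFun x := rfl
  show B.gFun x + creaseσ T.ε (T.w x) ≤ max (B.gFun x) (B.f x - T.c) + T.ε
  rcases le_total (T.w x) 0 with hw | hw
  · rw [max_eq_right hw] at h
    linarith [le_max_left (B.gFun x) (B.f x - T.c)]
  · rw [max_eq_left hw] at h
    linarith [le_max_right (B.gFun x) (B.f x - T.c)]

/-- `G ≤ M`. [folklore] -/
theorem gFun_le_M (x : X) : B.gFun x ≤ T.M x := (le_max_left _ _).trans (T.max_le_M x)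

/-- `f - c ≤ M`. [folklore] -/
theorem sub_le_M (x : X) : B.f x - T.c ≤ T.M x := (le_max_right _ _).trans (T.max_le_M x)

/-- Where `w ≤ -ε`, `M = G`. [folklore] -/
theorem M_eq_gFun_of_w_le {x : X} (h : T.w x ≤ -T.ε) : T.M x = B.gFun x := by
  rw [M, creaseσ_of_le_neg T.ε_pos h, add_zero]

/-- Where `ε ≤ w`, `M = f - c`. [folklore] -/
theorem M_eq_sub_of_le_w {x : X} (h : T.ε ≤ T.w x) : T.M x = B.f x - T.c := by
  rw [M, creaseσ_of_le T.ε_pos h, w]; ring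

/-- A point below `c` with `M = 0` has `w < ε`. [folklore] -/
theorem w_lt_of_M_eq_zero {x : X} (h0 : T.M x = 0) (hxc : B.f x < T.c) : T.w x < T.ε := by
  by_contra h
  have := T.M_eq_sub_of_le_w (not_lt.1 h)
  linarith

/-- A point with `M = 0` and `w ≤ -ε` lands on `F`: `G = 0`. [folklore] -/
theorem gFun_eq_zero_of_M_eq_zero {x : X} (h0 : T.M x = 0) (hw : T.w x ≤ -T.ε) : B.gFun x = 0 := by
  rw [← T.M_eq_gFun_of_w_le hw]; exact h0

/-- The generic part of `X₂`: outside `X₁`, below `c`, hitting the level, with `M < 0` (landing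
in `{g < b}`, below the rounded top). [cite: GayKirby2016, §4, Lemma 14] -/
def S₂ : Set X := {x | x ∉ T.X₁ ∧ B.f x < T.c ∧ B.Hit x ∧ T.M x < 0}

/-- The generic part of `X₃`: outside `X₁`, hitting the level, with `M > 0`.
[cite: GayKirby2016, §4, Lemma 14] -/
def S₃ : Set X := {x | x ∉ T.X₁ ∧ B.Hit x ∧ 0 < T.M x}

/-- **The ascending sheets**: the points of `{a ≤ f ≤ c}` which do not hit the level (by the
dichotomy `MorseFrame.hit_or_exists_mem_unstableSet`, the points of the unstable sets of the
critical points between `a` and `c` — the cores of the `2`-handles). [cite: GayKirby2016, §4, Lemma 14] -/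
def sheets : Set X := {x | B.a ≤ B.f x ∧ B.f x ≤ T.c ∧ ¬ B.Hit x}

/-- **The second sector** `X₂ = closure S₂ ∪ sheets` (collar over `H₁₂` and the `2`-handles,
with rounded top). [cite: GayKirby2016, §4, Lemma 14] -/
def X₂ : Set X := closure T.S₂ ∪ T.sheets

/-- **The third sector** `X₃ = closure S₃ ∪ {f ≥ c}`. [cite: GayKirby2016, §4, Lemma 14] -/
def X₃ : Set X := closure T.S₃ ∪ {x | T.c ≤ B.f x}

/-- `X₁` is closed. [folklore] -/
theorem isClosed_X₁ : IsClosed T.X₁ := T.D.isClosed_sector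

/-- The sheets form a closed set (the set of points which hit is open). [folklore] -/
theorem isClosed_sheets : IsClosed T.sheets := by
  have h1 : IsClosed {x : X | B.a ≤ B.f x} := isClosed_le continuous_const B.U.contMDiff_f.continuous
  have h2 : IsClosed {x : X | B.f x ≤ T.c} := isClosed_le B.U.contMDiff_f.continuous continuous_const
  have h3 : IsClosed {x : X | B.Hit x}ᶜ := T.Fr.isOpen_setOf_hit.isClosed_compl
  have h : T.sheets = {x : X | B.a ≤ B.f x} ∩ {x : X | B.f x ≤ T.c} ∩ {x : X | B.Hit x}ᶜ := by
    ext x; simp only [sheets, mem_setOf_eq, mem_inter_iff, mem_compl_iff]; tauto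
  rw [h]
  exact (h1.inter h2).inter h3

/-- `X₂` is closed. [folklore] -/
theorem isClosed_X₂ : IsClosed T.X₂ := isClosed_closure.union T.isClosed_sheets

/-- `X₃` is closed. [folklore] -/
theorem isClosed_X₃ : IsClosed T.X₃ :=
  isClosed_closure.union (isClosed_le continuous_const B.U.contMDiff_f.continuous)

/-- `S₂ ⊆ X₂`. [folklore] -/
theorem S₂_subset_X₂ : T.S₂ ⊆ T.X₂ := fun _ hx => Or.inl (subset_closure hx)

/-- `closure S₂ ⊆ X₂`. [folklore] -/
theorem closure_S₂_subset_X₂ : closure T.S₂ ⊆ T.X₂ := fun _ hx => Or.inl hx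

/-- `sheets ⊆ X₂`. [cite: GayKirby2016, §4, Lemma 14] -/
theorem sheets_subset_X₂ : T.sheets ⊆ T.X₂ := fun _ hx => Or.inr hx

/-- `S₃ ⊆ X₃`. [folklore] -/
theorem S₃_subset_X₃ : T.S₃ ⊆ T.X₃ := fun _ hx => Or.inl (subset_closure hx)

/-- `{f ≥ c} ⊆ X₃`. [cite: GayKirby2016, §4, Lemma 14] -/
theorem mem_X₃_of_le {x : X} (hx : T.c ≤ B.f x) : x ∈ T.X₃ := Or.inr hx

/-- **Outside `X₁`, a point which does not hit the level lies on or above it**: below the level,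
outside `X₁` means inside the bevel, hence inside the band of `U`, whose points hit.
[cite: GayKirby2016, §4, Lemma 14] -/
theorem a_le_of_not_mem_X₁_of_not_hit {x : X} (hx₁ : x ∉ T.X₁) (hx : ¬ B.Hit x) : B.a ≤ B.f x := by
  by_contra h
  have hlt : B.f x < B.a := not_le.1 h
  have hs : -(T.D.κ * T.D.χ₂.rOut) < B.sFun x := by
    by_contra h'
    exact hx₁ (T.D.mem_sector_of_sFun_le (not_lt.1 h'))
  have h1 : T.D.κ * T.D.χ₂.rOut < B.U.δ := T.D.κ_mul_rOut₂_lt.trans T.D.rIn₁_lt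
  have h2 : B.f x = B.a + B.sFun x := B.f_eq_add_sFun x
  apply hx (B.hit_of_mem_band _)
  rw [LevelUnitField.mem_band_iff]
  exact ⟨by linarith, by linarith [B.U.δ_pos]⟩

/-! ### Points with `M = 0` below `c` are in the closure of both generic parts -/

/-- The crease coordinate along a trajectory: `w (fl x t) = f (fl x t) - c - G x`. [folklore] -/
theorem w_fl {x : X} (hx : B.Hit x) (t : ℝ) : T.w (B.U.fl x t) = B.f (B.U.fl x t) - T.c - B.gFun x := by
  rw [w, T.Fr.gFun_fl hx]

/-- **Case `w > -ε`: a point outside `X₁`, below `c`, with `M = 0` is in the closure of `S₂`**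
— flow it backwards: `G` is unchanged, `f` decreases, and `σ_ε` is strictly increasing on
`[-ε, ∞)`, so `M` becomes negative. [cite: GayKirby2016, §4, Lemma 14] -/
theorem mem_closure_S₂_of_M_eq_zero_of_lt_w {x : X} (hx₁ : x ∉ T.X₁) (hxc : B.f x < T.c) (hx : B.Hit x)
    (h0 : T.M x = 0) (hw : -T.ε < T.w x) : x ∈ closure T.S₂ := by
  have hcont := B.tendsto_fl_neg x
  apply mem_closure_of_tendsto hcont
  have h1 : ∀ᶠ t : ℝ in 𝓝[>] 0, B.U.fl x (-t) ∈ T.X₁ᶜ := hcont (T.isClosed_X₁.isOpen_compl.mem_nhds hx₁)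
  have h2 : ∀ᶠ t : ℝ in 𝓝[>] 0, B.U.fl x (-t) ∈ {y | B.f y < T.c} :=
    hcont ((isOpen_lt B.U.contMDiff_f.continuous continuous_const).mem_nhds hxc)
  have hwx : T.w x = B.f x - T.c - B.gFun x := rfl
  have h3 : ∀ᶠ t : ℝ in 𝓝[>] 0, B.U.fl x (-t) ∈ {y | T.c + B.gFun x - T.ε < B.f y} :=
    hcont ((isOpen_lt continuous_const B.U.contMDiff_f.continuous).mem_nhds
      (by show T.c + B.gFun x - T.ε < B.f x; linarith))
  filter_upwards [h1, h2, h3, self_mem_nhdsWithin] with t ht1 ht2 ht3 ht0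
  have ht0 : 0 < t := ht0
  have ht3 : T.c + B.gFun x - T.ε < B.f (B.U.fl x (-t)) := ht3
  refine ⟨ht1, ht2, B.hit_fl hx (-t), ?_⟩
  have hwt : T.w (B.U.fl x (-t)) = B.f (B.U.fl x (-t)) - T.c - B.gFun x := T.w_fl hx (-t)
  have hwlt : T.w (B.U.fl x (-t)) < T.w x := by rw [hwt, hwx]; linarith [T.Fr.f_fl_lt_of_pos hx ht0]
  have hwge : -T.ε ≤ T.w (B.U.fl x (-t)) := by rw [hwt]; linarith
  have hσ : creaseσ T.ε (T.w (B.U.fl x (-t))) < creaseσ T.ε (T.w x) :=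
    strictMonoOn_creaseσ T.ε_pos hwge hw.le hwlt
  have hM : B.gFun x + creaseσ T.ε (T.w x) = 0 := h0
  show B.gFun (B.U.fl x (-t)) + creaseσ T.ε (T.w (B.U.fl x (-t))) < 0
  rw [T.Fr.gFun_fl hx]
  linarith

/-- **Case `w > -ε` for `S₃`**: flow forwards. [cite: GayKirby2016, §4, Lemma 14] -/
theorem mem_closure_S₃_of_M_eq_zero_of_lt_w {x : X} (hx₁ : x ∉ T.X₁) (hx : B.Hit x)
    (h0 : T.M x = 0) (hw : -T.ε < T.w x) : x ∈ closure T.S₃ := by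
  have hcont := B.tendsto_fl x
  apply mem_closure_of_tendsto hcont
  have h1 : ∀ᶠ t : ℝ in 𝓝[>] 0, B.U.fl x t ∈ T.X₁ᶜ := hcont (T.isClosed_X₁.isOpen_compl.mem_nhds hx₁)
  have hwx : T.w x = B.f x - T.c - B.gFun x := rfl
  filter_upwards [h1, self_mem_nhdsWithin] with t ht1 ht0
  have ht0 : 0 < t := ht0
  refine ⟨ht1, B.hit_fl hx t, ?_⟩
  have hwt : T.w (B.U.fl x t) = B.f (B.U.fl x t) - T.c - B.gFun x := T.w_fl hx t
  have hwlt : T.w x < T.w (B.U.fl x t) := by rw [hwt, hwx]; linarith [T.Fr.lt_f_fl_of_pos hx ht0]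
  have hσ : creaseσ T.ε (T.w x) < creaseσ T.ε (T.w (B.U.fl x t)) :=
    strictMonoOn_creaseσ T.ε_pos hw.le (by show -T.ε ≤ T.w (B.U.fl x t); linarith) hwlt
  have hM : B.gFun x + creaseσ T.ε (T.w x) = 0 := h0
  show 0 < B.gFun (B.U.fl x t) + creaseσ T.ε (T.w (B.U.fl x t))
  rw [T.Fr.gFun_fl hx]
  linarith

/-- **Case `w ≤ -ε`: a point outside `X₁`, below `c`, with `M = 0` is in the closure of `S₂`.**
Here `M = G` near the point, so it lands on `F` (`G = 0`); slide the landing point into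
`{g < b}` (`BiCollar.slide`): along the slide `G = -t` exactly while `σ_ε(w)` has derivative
`σ_ε'(w) · w' = 0` at `t = 0` (`σ_ε' = 0` on `(-∞, -ε]`), so `M` has derivative `-1` and
becomes negative. [cite: GayKirby2016, §4, Lemma 14] -/
theorem mem_closure_S₂_of_M_eq_zero_of_w_le {x : X} (hx₁ : x ∉ T.X₁) (hxc : B.f x < T.c) (hx : B.Hit x)
    (h0 : T.M x = 0) (hw : T.w x ≤ -T.ε) : x ∈ closure T.S₂ := by
  have hG : B.gFun x = 0 := T.gFun_eq_zero_of_M_eq_zero h0 hw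
  obtain ⟨τ, hτ⟩ : ∃ τ, B.U.fl (B.lam x) τ = x := mem_range_flow_levelProj B.U.contMDiff B.a x
  have hs0 : B.slide x τ 0 = x := B.slide_zero hx hτ
  have hcont : Tendsto (fun t => B.slide x τ (-t)) (𝓝[>] (0 : ℝ)) (𝓝 x) := by
    have h := ((B.continuous_slide x τ).comp continuous_neg).continuousAt (x := (0 : ℝ))
    rw [ContinuousAt, Function.comp_apply, neg_zero, hs0] at h
    exact h.mono_left nhdsWithin_le_nhds
  apply mem_closure_of_tendsto hcont
  have h1 : ∀ᶠ t : ℝ in 𝓝[>] 0, B.slide x τ (-t) ∈ T.X₁ᶜ :=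
    hcont (T.isClosed_X₁.isOpen_compl.mem_nhds hx₁)
  have h2 : ∀ᶠ t : ℝ in 𝓝[>] 0, B.slide x τ (-t) ∈ {y | B.f y < T.c} :=
    hcont ((isOpen_lt B.U.contMDiff_f.continuous continuous_const).mem_nhds hxc)
  -- the derivative of `M` along the slide at `t = 0` is `-1`
  set u : ℝ → ℝ := fun t => B.f (B.slide x τ (-t)) - T.c + t with hu
  have hu0 : u 0 = T.w x := by
    simp only [hu, neg_zero, hs0, add_zero]
    rw [w, hG, sub_zero]
  obtain ⟨d, hd⟩ : ∃ d, HasDerivAt u d 0 := by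
    have hF := (B.hasDerivAt_f_slide x τ (-0)).comp (0 : ℝ) (hasDerivAt_neg (0 : ℝ))
    exact ⟨_, (hF.sub_const T.c).add (hasDerivAt_id' (0 : ℝ))⟩
  have hψ : HasDerivAt (fun t => creaseσ T.ε (u t)) 0 0 := by
    have h := (hasDerivAt_creaseσ T.ε_pos (u 0)).comp (0 : ℝ) hd
    have hz : creaseStep (u 0 / T.ε) = 0 := by
      rw [hu0]
      exact creaseStep_of_le_neg_one (by rw [div_le_iff₀ T.ε_pos]; linarith)
    rw [hz, zero_mul] at h
    exact h
  have hφ' : HasDerivAt (fun t => -t + creaseσ T.ε (u t)) (-1) 0 := by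
    have h := (hasDerivAt_neg' (0 : ℝ)).add hψ
    rw [add_zero] at h
    exact h
  -- near `0`, `M (slide x τ (-t)) = -t + σ_ε (u t)` (the clock of `V`: `G = -t`)
  have hMφ : (fun t => T.M (B.slide x τ (-t))) =ᶠ[𝓝 0] fun t => -t + creaseσ T.ε (u t) := by
    have hI : Ioo (-B.V.δ) B.V.δ ∈ 𝓝 (0 : ℝ) := Ioo_mem_nhds (by linarith [B.V.δ_pos]) B.V.δ_pos
    filter_upwards [hI] with t ht
    have hGt : B.gFun (B.slide x τ (-t)) = -t :=
      T.Fr.gFun_slide hG τ ⟨by linarith [ht.2], by linarith [ht.1]⟩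
    show B.gFun (B.slide x τ (-t)) + creaseσ T.ε (T.w (B.slide x τ (-t))) = -t + creaseσ T.ε (u t)
    rw [w, hGt]
    simp only [hu, sub_neg_eq_add]
  have hφ : HasDerivAt (fun t => T.M (B.slide x τ (-t))) (-1) 0 := hφ'.congr_of_eventuallyEq hMφ
  have hφ0 : T.M (B.slide x τ (-0)) = 0 := by rw [neg_zero, hs0]; exact h0
  have h4 := eventually_neg_of_hasDerivAt hφ hφ0
  filter_upwards [h1, h2, h4] with t ht1 ht2 ht4
  exact ⟨ht1, ht2, B.hit_slide x τ (-t), ht4⟩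

/-- **Case `w ≤ -ε` for `S₃`**: slide the landing point into `{g > b}`. [cite: GayKirby2016, §4, Lemma 14] -/
theorem mem_closure_S₃_of_M_eq_zero_of_w_le {x : X} (hx₁ : x ∉ T.X₁) (hx : B.Hit x)
    (h0 : T.M x = 0) (hw : T.w x ≤ -T.ε) : x ∈ closure T.S₃ := by
  have hG : B.gFun x = 0 := T.gFun_eq_zero_of_M_eq_zero h0 hw
  obtain ⟨τ, hτ⟩ : ∃ τ, B.U.fl (B.lam x) τ = x := mem_range_flow_levelProj B.U.contMDiff B.a x
  have hs0 : B.slide x τ 0 = x := B.slide_zero hx hτ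
  have hcont : Tendsto (fun t => B.slide x τ t) (𝓝[>] (0 : ℝ)) (𝓝 x) := by
    have h := (B.continuous_slide x τ).continuousAt (x := (0 : ℝ))
    rw [ContinuousAt, hs0] at h
    exact h.mono_left nhdsWithin_le_nhds
  apply mem_closure_of_tendsto hcont
  have h1 : ∀ᶠ t : ℝ in 𝓝[>] 0, B.slide x τ t ∈ T.X₁ᶜ :=
    hcont (T.isClosed_X₁.isOpen_compl.mem_nhds hx₁)
  set u : ℝ → ℝ := fun t => B.f (B.slide x τ t) - T.c - t with hu
  have hu0 : u 0 = T.w x := by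
    simp only [hu, hs0, sub_zero]
    rw [w, hG, sub_zero]
  obtain ⟨d, hd⟩ : ∃ d, HasDerivAt u d 0 :=
    ⟨_, ((B.hasDerivAt_f_slide x τ 0).sub_const T.c).sub (hasDerivAt_id' (0 : ℝ))⟩
  have hψ : HasDerivAt (fun t => creaseσ T.ε (u t)) 0 0 := by
    have h := (hasDerivAt_creaseσ T.ε_pos (u 0)).comp (0 : ℝ) hd
    have hz : creaseStep (u 0 / T.ε) = 0 := by
      rw [hu0]
      exact creaseStep_of_le_neg_one (by rw [div_le_iff₀ T.ε_pos]; linarith)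
    rw [hz, zero_mul] at h
    exact h
  have hφ' : HasDerivAt (fun t => t + creaseσ T.ε (u t)) 1 0 := by
    have h := (hasDerivAt_id' (0 : ℝ)).add hψ
    rw [add_zero] at h
    exact h
  have hMφ : (fun t => T.M (B.slide x τ t)) =ᶠ[𝓝 0] fun t => t + creaseσ T.ε (u t) := by
    have hI : Ioo (-B.V.δ) B.V.δ ∈ 𝓝 (0 : ℝ) := Ioo_mem_nhds (by linarith [B.V.δ_pos]) B.V.δ_pos
    filter_upwards [hI] with t ht
    have hGt : B.gFun (B.slide x τ t) = t := T.Fr.gFun_slide hG τ ht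
    show B.gFun (B.slide x τ t) + creaseσ T.ε (T.w (B.slide x τ t)) = t + creaseσ T.ε (u t)
    rw [w, hGt]
  have hφ : HasDerivAt (fun t => T.M (B.slide x τ t)) 1 0 := hφ'.congr_of_eventuallyEq hMφ
  have hφ0 : T.M (B.slide x τ 0) = 0 := by rw [hs0]; exact h0
  have h4 := eventually_pos_of_hasDerivAt hφ hφ0
  filter_upwards [h1, h4] with t ht1 ht4
  exact ⟨ht1, B.hit_slide x τ t, ht4⟩

/-- **A point outside `X₁`, below `c`, which hits and has `M = 0` is in the closure of `S₂`.**
[cite: GayKirby2016, §4, Lemma 14] -/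
theorem mem_closure_S₂_of_M_eq_zero {x : X} (hx₁ : x ∉ T.X₁) (hxc : B.f x < T.c) (hx : B.Hit x)
    (h0 : T.M x = 0) : x ∈ closure T.S₂ := by
  rcases lt_or_ge (-T.ε) (T.w x) with hw | hw
  · exact T.mem_closure_S₂_of_M_eq_zero_of_lt_w hx₁ hxc hx h0 hw
  · exact T.mem_closure_S₂_of_M_eq_zero_of_w_le hx₁ hxc hx h0 hw

/-- **A point outside `X₁` which hits and has `M = 0` is in the closure of `S₃`.**
[cite: GayKirby2016, §4, Lemma 14] -/
theorem mem_closure_S₃_of_M_eq_zero {x : X} (hx₁ : x ∉ T.X₁) (hx : B.Hit x)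
    (h0 : T.M x = 0) : x ∈ closure T.S₃ := by
  rcases lt_or_ge (-T.ε) (T.w x) with hw | hw
  · exact T.mem_closure_S₃_of_M_eq_zero_of_lt_w hx₁ hx h0 hw
  · exact T.mem_closure_S₃_of_M_eq_zero_of_w_le hx₁ hx h0 hw

/-! ### The cover `X = X₁ ∪ X₂ ∪ X₃` -/

/-- **A point outside `X₁`, below `c`, which does not hit the level lies on a sheet, in `X₂`.**
[cite: GayKirby2016, §4, Lemma 14] -/
theorem mem_X₂_of_not_hit {x : X} (hx₁ : x ∉ T.X₁) (hxc : B.f x ≤ T.c) (hx : ¬ B.Hit x) : x ∈ T.X₂ :=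
  T.sheets_subset_X₂ ⟨T.a_le_of_not_mem_X₁_of_not_hit hx₁ hx, hxc, hx⟩

/-- **The three sectors cover `X`.** [cite: GayKirby2016, §4, Lemma 14] -/
theorem mem_X₁_or_mem_X₂_or_mem_X₃ (x : X) : x ∈ T.X₁ ∨ x ∈ T.X₂ ∨ x ∈ T.X₃ := by
  by_cases h1 : x ∈ T.X₁
  · exact Or.inl h1
  by_cases hc : T.c ≤ B.f x
  · exact Or.inr (Or.inr (T.mem_X₃_of_le hc))
  have hxc : B.f x < T.c := not_le.1 hc
  by_cases hh : B.Hit x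
  · rcases lt_trichotomy (T.M x) 0 with hlt | heq | hgt
    · exact Or.inr (Or.inl (T.S₂_subset_X₂ ⟨h1, hxc, hh, hlt⟩))
    · exact Or.inr (Or.inl (T.closure_S₂_subset_X₂ (T.mem_closure_S₂_of_M_eq_zero h1 hxc hh heq)))
    · exact Or.inr (Or.inr (T.S₃_subset_X₃ ⟨h1, hh, hgt⟩))
  · exact Or.inr (Or.inl (T.mem_X₂_of_not_hit h1 hxc.le hh))

/-- The cover as an equality of sets. [cite: GayKirby2016, §4, Lemma 14] -/
theorem iUnion_eq_univ : (⋃ i, ![T.X₁, T.X₂, T.X₃] i) = univ := by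
  refine eq_univ_of_forall fun x => ?_
  rw [mem_iUnion]
  rcases T.mem_X₁_or_mem_X₂_or_mem_X₃ x with h | h | h
  · exact ⟨0, h⟩
  · exact ⟨1, h⟩
  · exact ⟨2, h⟩


/-! ### The sectors near `F`: wedges in the bi-collar box -/

/-- Points of the bi-collar box of radius `ε_w` lie in the band of `U`. [folklore] -/
theorem mem_band_of_mem_box {x : X} (hx : x ∈ B.box T.D.εw) : x ∈ B.U.band :=
  B.mem_band_U (hx.1.trans_le T.D.εw_le_δU)

/-- Points of the box hit the level. [folklore] -/
theorem hit_of_mem_box {x : X} (hx : x ∈ B.box T.D.εw) : B.Hit x :=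
  B.hit_of_mem_band (T.mem_band_of_mem_box hx)

/-- Points of the box lie below the top level. [folklore] -/
theorem f_lt_c_of_mem_box {x : X} (hx : x ∈ B.box T.D.εw) : B.f x < T.c := by
  have h1 : B.sFun x < T.D.εw := (abs_lt.1 hx.1).2
  have h2 := T.D.εw_le_δU
  have h3 := T.band_le_c
  rw [B.f_eq_add_sFun]
  linarith

/-- On the box, `G = r`. [cite: GayKirby2016, §4, Lemma 14] -/
theorem gFun_eq_rFun_of_mem_box {x : X} (hx : x ∈ B.box T.D.εw) : B.gFun x = B.rFun x :=
  T.Fr.gFun_eq_rFun (T.mem_band_of_mem_box hx)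

/-- On the box, `w ≤ -ε`: no rounding takes place there. [folklore] -/
theorem w_le_of_mem_box {x : X} (hx : x ∈ B.box T.D.εw) : T.w x ≤ -T.ε := by
  have h1 : B.sFun x < T.D.εw := (abs_lt.1 hx.1).2
  have h2 : -T.D.εw < B.rFun x := (abs_lt.1 hx.2).1
  have h3 := T.ε_le
  rw [w, T.gFun_eq_rFun_of_mem_box hx, B.f_eq_add_sFun]
  linarith

/-- **On the box, `M = r`.** [cite: GayKirby2016, §4, Lemma 14] -/
theorem M_eq_rFun_of_mem_box {x : X} (hx : x ∈ B.box T.D.εw) : T.M x = B.rFun x := by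
  rw [T.M_eq_gFun_of_w_le (T.w_le_of_mem_box hx), T.gFun_eq_rFun_of_mem_box hx]

/-- On the box, `X₁ = {s + κ |r| ≤ 0}`. [cite: GayKirby2016, Def. 1 and Fig. 1] -/
theorem mem_X₁_iff_of_mem_box {x : X} (hx : x ∈ B.box T.D.εw) :
    x ∈ T.X₁ ↔ B.sFun x + T.D.κ * |B.rFun x| ≤ 0 := by
  show T.D.F₁ x ≤ 0 ↔ _
  rw [BevelData.F₁, T.D.θ_eq_abs_of_mem_box hx]

/-- `r` is continuous at points of the box. [folklore] -/
theorem continuousAt_rFun {x : X} (hx : x ∈ B.box T.D.εw) : ContinuousAt B.rFun x :=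
  B.continuousOn_rFun.continuousAt (B.U.isOpen_band.mem_nhds (T.mem_band_of_mem_box hx))

/-- On the box, points of `S₂` have `r < 0` and `s - κ r > 0`. [cite: GayKirby2016, §4, Lemma 14] -/
theorem wedge₂_of_mem_S₂ {x : X} (hx : x ∈ B.box T.D.εw) (h : x ∈ T.S₂) :
    B.rFun x < 0 ∧ 0 < B.sFun x - T.D.κ * B.rFun x := by
  have hr : B.rFun x < 0 := by rw [← T.M_eq_rFun_of_mem_box hx]; exact h.2.2.2
  refine ⟨hr, ?_⟩
  have h1 : ¬ (B.sFun x + T.D.κ * |B.rFun x| ≤ 0) := fun h' => h.1 ((T.mem_X₁_iff_of_mem_box hx).2 h')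
  rw [abs_of_neg hr] at h1
  linarith [not_le.1 h1]

/-- On the box, points of `S₃` have `r > 0` and `s + κ r > 0`. [cite: GayKirby2016, §4, Lemma 14] -/
theorem wedge₃_of_mem_S₃ {x : X} (hx : x ∈ B.box T.D.εw) (h : x ∈ T.S₃) :
    0 < B.rFun x ∧ 0 < B.sFun x + T.D.κ * B.rFun x := by
  have hr : 0 < B.rFun x := by rw [← T.M_eq_rFun_of_mem_box hx]; exact h.2.2
  refine ⟨hr, ?_⟩
  have h1 : ¬ (B.sFun x + T.D.κ * |B.rFun x| ≤ 0) := fun h' => h.1 ((T.mem_X₁_iff_of_mem_box hx).2 h')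
  rw [abs_of_pos hr] at h1
  exact not_le.1 h1

omit [T2Space X] [CompactSpace X] [ChartedSpace (EuclideanSpace ℝ (Fin 4)) X] [IsManifold (𝓡 4) ∞ X] in
/-- A function continuous at `x` which is nonnegative on a set whose closure contains `x` is
nonnegative at `x`. [folklore] -/
theorem _root_.Literature.Topology.FourManifolds.nonneg_of_mem_closure {φ : X → ℝ} {A : Set X} {x : X} (hφ : ContinuousAt φ x)
    (hx : x ∈ closure A) (hA : ∀ y ∈ A, 0 ≤ φ y) : 0 ≤ φ x := by
  have hmem : φ x ∈ closure (φ '' A) := hφ.continuousWithinAt.mem_closure_image hx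
  have hsub : φ '' A ⊆ Ici 0 := by rintro _ ⟨y, hy, rfl⟩; exact hA y hy
  exact closure_minimal hsub isClosed_Ici hmem

/-- **On the box, `X₂` is the wedge `{r ≤ 0, s - κ r ≥ 0}`** (`⊆`). [cite: GayKirby2016, Def. 1 and Fig. 1] -/
theorem wedge₂_of_mem_X₂ {x : X} (hx : x ∈ B.box T.D.εw) (h : x ∈ T.X₂) :
    B.rFun x ≤ 0 ∧ 0 ≤ B.sFun x - T.D.κ * B.rFun x := by
  have h' : x ∈ closure T.S₂ := by
    rcases h with h | h
    · exact h
    · exact absurd (T.hit_of_mem_box hx) h.2.2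
  have hO : IsOpen (B.box T.D.εw) := B.isOpen_box T.D.εw_le_δU
  have hcl : x ∈ closure (B.box T.D.εw ∩ T.S₂) := hO.inter_closure ⟨hx, h'⟩
  have hr : ContinuousAt B.rFun x := T.continuousAt_rFun hx
  have hs : ContinuousAt B.sFun x := B.contMDiff_sFun.continuous.continuousAt
  constructor
  · have := nonneg_of_mem_closure (φ := fun y => -B.rFun y) hr.neg hcl
      (fun y hy => by have := (T.wedge₂_of_mem_S₂ hy.1 hy.2).1; linarith)
    simpa using this
  · exact nonneg_of_mem_closure (φ := fun y => B.sFun y - T.D.κ * B.rFun y)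
      (hs.sub (continuousAt_const.mul hr)) hcl (fun y hy => (T.wedge₂_of_mem_S₂ hy.1 hy.2).2.le)

/-- **On the box, `X₃` is the wedge `{r ≥ 0, s + κ r ≥ 0}`** (`⊆`). [cite: GayKirby2016, Def. 1 and Fig. 1] -/
theorem wedge₃_of_mem_X₃ {x : X} (hx : x ∈ B.box T.D.εw) (h : x ∈ T.X₃) :
    0 ≤ B.rFun x ∧ 0 ≤ B.sFun x + T.D.κ * B.rFun x := by
  have h' : x ∈ closure T.S₃ := by
    rcases h with h | h
    · exact h
    · exact absurd (T.f_lt_c_of_mem_box hx) (not_lt.2 h)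
  have hO : IsOpen (B.box T.D.εw) := B.isOpen_box T.D.εw_le_δU
  have hcl : x ∈ closure (B.box T.D.εw ∩ T.S₃) := hO.inter_closure ⟨hx, h'⟩
  have hr : ContinuousAt B.rFun x := T.continuousAt_rFun hx
  have hs : ContinuousAt B.sFun x := B.contMDiff_sFun.continuous.continuousAt
  exact ⟨nonneg_of_mem_closure (φ := B.rFun) hr hcl (fun y hy => (T.wedge₃_of_mem_S₃ hy.1 hy.2).1.le),
    nonneg_of_mem_closure (φ := fun y => B.sFun y + T.D.κ * B.rFun y)
      (hs.add (continuousAt_const.mul hr)) hcl (fun y hy => (T.wedge₃_of_mem_S₃ hy.1 hy.2).2.le)⟩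

/-- The perturbation `ε ↦ Ψ (zL x) (r x + σ ε) (s x + ε)` tends to `x` as `ε → 0⁺`, for `x` in
the box. [folklore] -/
theorem tendsto_Ψ_perturb {x : X} (hx : x ∈ B.box T.D.εw) (σ : ℝ) :
    Tendsto (fun ε : ℝ => B.Ψ (B.zL x) (B.rFun x + σ * ε) (B.sFun x + ε)) (𝓝[>] (0 : ℝ)) (𝓝 x) := by
  have hc : Continuous fun ε : ℝ => B.Ψ (B.zL x) (B.rFun x + σ * ε) (B.sFun x + ε) :=
    B.contMDiff_Ψ.continuous.comp ((continuous_const.prodMk (continuous_const.add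
      (continuous_const.mul continuous_id))).prodMk (continuous_const.add continuous_id))
  have h0 : B.Ψ (B.zL x) (B.rFun x + σ * 0) (B.sFun x + 0) = x := by
    rw [mul_zero, add_zero, add_zero]
    exact B.Ψ_zL (hx.1.trans_le T.D.εw_le_δU) (hx.2.trans_le T.D.εw_le_δV)
  have h := hc.continuousAt (x := (0 : ℝ))
  rw [ContinuousAt, h0] at h
  exact h.mono_left nhdsWithin_le_nhds

/-- For small `ε > 0` the perturbed point stays in the box, with the expected coordinates.
[folklore] -/
theorem eventually_Ψ_perturb {x : X} (hx : x ∈ B.box T.D.εw) {σ : ℝ} (hσ : |σ| ≤ 1) :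
    ∀ᶠ ε : ℝ in 𝓝[>] (0 : ℝ), 0 < ε ∧
      B.Ψ (B.zL x) (B.rFun x + σ * ε) (B.sFun x + ε) ∈ B.box T.D.εw ∧
      B.rFun (B.Ψ (B.zL x) (B.rFun x + σ * ε) (B.sFun x + ε)) = B.rFun x + σ * ε ∧
      B.sFun (B.Ψ (B.zL x) (B.rFun x + σ * ε) (B.sFun x + ε)) = B.sFun x + ε := by
  set η : ℝ := min (T.D.εw - |B.rFun x|) (T.D.εw - |B.sFun x|) with hη
  have hη0 : 0 < η := lt_min (by linarith [hx.2]) (by linarith [hx.1])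
  filter_upwards [Ioo_mem_nhdsGT hη0] with ε hε
  have hε0 : 0 < ε := hε.1
  have hεr : ε < T.D.εw - |B.rFun x| := hε.2.trans_le (min_le_left _ _)
  have hεs : ε < T.D.εw - |B.sFun x| := hε.2.trans_le (min_le_right _ _)
  have hr : |B.rFun x + σ * ε| < T.D.εw := by
    have h1 : |σ * ε| ≤ ε := by
      rw [abs_mul, abs_of_pos hε0]; exact mul_le_of_le_one_left hε0.le hσ
    calc |B.rFun x + σ * ε| ≤ |B.rFun x| + |σ * ε| := abs_add_le _ _
      _ < T.D.εw := by linarith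
  have hs : |B.sFun x + ε| < T.D.εw := by
    calc |B.sFun x + ε| ≤ |B.sFun x| + |ε| := abs_add_le _ _
      _ < T.D.εw := by rw [abs_of_pos hε0]; linarith
  have hrI : B.rFun x + σ * ε ∈ Ioo (-B.V.δ) B.V.δ := by
    have := T.D.εw_le_δV; rw [abs_lt] at hr; exact ⟨by linarith [hr.1], by linarith [hr.2]⟩
  have hsI : B.sFun x + ε ∈ Ioo (-B.U.δ) B.U.δ := by
    have := T.D.εw_le_δU; rw [abs_lt] at hs; exact ⟨by linarith [hs.1], by linarith [hs.2]⟩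
  exact ⟨hε0, B.Ψ_mem_box T.D.εw_le_δU T.D.εw_le_δV _ hr hs, B.rFun_Ψ _ hrI hsI, B.sFun_Ψ _ _ hsI⟩

/-- **On the box, the wedge `{r ≤ 0, s - κ r ≥ 0}` lies in `X₂`** (perturb into `S₂` with
`(r - ε, s + ε)`). [cite: GayKirby2016, Def. 1 and Fig. 1] -/
theorem mem_X₂_of_wedge₂ {x : X} (hx : x ∈ B.box T.D.εw) (hr : B.rFun x ≤ 0)
    (hs : 0 ≤ B.sFun x - T.D.κ * B.rFun x) : x ∈ T.X₂ := by
  left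
  apply mem_closure_of_tendsto (T.tendsto_Ψ_perturb hx (-1))
  filter_upwards [T.eventually_Ψ_perturb hx (σ := -1) (by norm_num)] with ε hε
  obtain ⟨hε0, hbox, hrε, hsε⟩ := hε
  have hκ := T.D.κ_pos
  have hrneg : B.rFun (B.Ψ (B.zL x) (B.rFun x + -1 * ε) (B.sFun x + ε)) < 0 := by rw [hrε]; linarith
  refine ⟨fun h1 => ?_, T.f_lt_c_of_mem_box hbox, T.hit_of_mem_box hbox, ?_⟩
  · rw [T.mem_X₁_iff_of_mem_box hbox, abs_of_neg hrneg, hrε, hsε] at h1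
    nlinarith
  · rw [T.M_eq_rFun_of_mem_box hbox]; exact hrneg

/-- **On the box, the wedge `{r ≥ 0, s + κ r ≥ 0}` lies in `X₃`** (perturb into `S₃` with
`(r + ε, s + ε)`). [cite: GayKirby2016, Def. 1 and Fig. 1] -/
theorem mem_X₃_of_wedge₃ {x : X} (hx : x ∈ B.box T.D.εw) (hr : 0 ≤ B.rFun x)
    (hs : 0 ≤ B.sFun x + T.D.κ * B.rFun x) : x ∈ T.X₃ := by
  left
  apply mem_closure_of_tendsto (T.tendsto_Ψ_perturb hx 1)
  filter_upwards [T.eventually_Ψ_perturb hx (σ := 1) (by norm_num)] with ε hε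
  obtain ⟨hε0, hbox, hrε, hsε⟩ := hε
  have hκ := T.D.κ_pos
  have hrpos : 0 < B.rFun (B.Ψ (B.zL x) (B.rFun x + 1 * ε) (B.sFun x + ε)) := by rw [hrε]; linarith
  refine ⟨fun h1 => ?_, T.hit_of_mem_box hbox, ?_⟩
  · rw [T.mem_X₁_iff_of_mem_box hbox, abs_of_pos hrpos, hrε, hsε] at h1
    nlinarith
  · rw [T.M_eq_rFun_of_mem_box hbox]; exact hrpos

/-! ### The corner charts of `X₂` and `X₃` along `F` -/

/-- The wedge frame of `X₂`: `u = s - κ r`, `v = -r`. [cite: GayKirby2016, Def. 1 and Fig. 1] -/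
def frame₂ : WedgeFrame where
  α := 1
  β := -T.D.κ
  γ := 0
  δ := -1
  det_ne_zero := by norm_num

/-- The wedge frame of `X₃`: `u = s + κ r`, `v = r`. [cite: GayKirby2016, Def. 1 and Fig. 1] -/
def frame₃ : WedgeFrame where
  α := 1
  β := T.D.κ
  γ := 0
  δ := 1
  det_ne_zero := by norm_num

/-- `u₂ = s - κ r`. [folklore] -/
theorem uFun_frame₂ (x : X) : B.uFun T.frame₂ x = B.sFun x - T.D.κ * B.rFun x := by
  simp only [BiCollar.uFun, WedgeFrame.u, frame₂]; ring

/-- `v₂ = -r`. [folklore] -/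
theorem vFun_frame₂ (x : X) : B.vFun T.frame₂ x = -B.rFun x := by
  simp only [BiCollar.vFun, WedgeFrame.v, frame₂]; ring

/-- `u₃ = s + κ r`. [folklore] -/
theorem uFun_frame₃ (x : X) : B.uFun T.frame₃ x = B.sFun x + T.D.κ * B.rFun x := by
  simp only [BiCollar.uFun, WedgeFrame.u, frame₃]; ring

/-- `v₃ = r`. [folklore] -/
theorem vFun_frame₃ (x : X) : B.vFun T.frame₃ x = B.rFun x := by
  simp only [BiCollar.vFun, WedgeFrame.v, frame₃]; ring

/-- **On the box, `X₂ = {u₂ ≥ 0, v₂ ≥ 0}`.** [cite: GayKirby2016, Def. 1 and Fig. 1] -/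
theorem mem_X₂_iff_of_mem_box {x : X} (hx : x ∈ B.box T.D.εw) :
    x ∈ T.X₂ ↔ 0 ≤ B.uFun T.frame₂ x ∧ 0 ≤ B.vFun T.frame₂ x := by
  rw [T.uFun_frame₂, T.vFun_frame₂]
  constructor
  · intro h
    have h' := T.wedge₂_of_mem_X₂ hx h
    exact ⟨h'.2, by linarith [h'.1]⟩
  · rintro ⟨hu, hv⟩
    exact T.mem_X₂_of_wedge₂ hx (by linarith) hu

/-- **On the box, `X₃ = {u₃ ≥ 0, v₃ ≥ 0}`.** [cite: GayKirby2016, Def. 1 and Fig. 1] -/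
theorem mem_X₃_iff_of_mem_box {x : X} (hx : x ∈ B.box T.D.εw) :
    x ∈ T.X₃ ↔ 0 ≤ B.uFun T.frame₃ x ∧ 0 ≤ B.vFun T.frame₃ x := by
  rw [T.uFun_frame₃, T.vFun_frame₃]
  constructor
  · intro h
    have h' := T.wedge₃_of_mem_X₃ hx h
    exact ⟨h'.2, h'.1⟩
  · rintro ⟨hu, hv⟩
    exact T.mem_X₃_of_wedge₃ hx hv hu

/-- **The corner-slice chart of `X₂` at a point of the box** (in particular at every point of
`F`), with corner locus `F`, normal coordinates `u₂, v₂` and retraction `π`.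
[cite: GayKirby2016, Def. 1 and Fig. 1; Douady1961, §1 and §4] -/
def cornerSliceChart₂ (p : X) :
    CornerSliceChart T.X₂ B.surface (B.uFun T.frame₂) (B.vFun T.frame₂) B.π :=
  B.cornerSliceChart T.frame₂ (chartAt (EuclideanSpace ℝ (Fin 2)) (B.zL p)) T.D.εw
    (IsManifold.chart_mem_maximalAtlas (B.zL p)) T.D.εw_pos T.D.εw_le_δU T.D.εw_le_δV
    (fun _ hx => T.mem_X₂_iff_of_mem_box hx) (fun x _ => B.mem_surface_iff x)

/-- A point of the box lies in the source of its corner-slice chart of `X₂`. [folklore] -/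
theorem mem_cornerSliceChart₂_source {p : X} (hp : p ∈ B.box T.D.εw) :
    p ∈ (T.cornerSliceChart₂ p).Θ.source :=
  B.mem_cornerSliceChart_source T.frame₂ T.D.εw_pos T.D.εw_le_δU T.D.εw_le_δV
    (fun _ hx => T.mem_X₂_iff_of_mem_box hx) (fun x _ => B.mem_surface_iff x) hp

/-- **The corner-slice chart of `X₃` at a point of the box.**
[cite: GayKirby2016, Def. 1 and Fig. 1; Douady1961, §1 and §4] -/
def cornerSliceChart₃ (p : X) :
    CornerSliceChart T.X₃ B.surface (B.uFun T.frame₃) (B.vFun T.frame₃) B.π :=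
  B.cornerSliceChart T.frame₃ (chartAt (EuclideanSpace ℝ (Fin 2)) (B.zL p)) T.D.εw
    (IsManifold.chart_mem_maximalAtlas (B.zL p)) T.D.εw_pos T.D.εw_le_δU T.D.εw_le_δV
    (fun _ hx => T.mem_X₃_iff_of_mem_box hx) (fun x _ => B.mem_surface_iff x)

/-- A point of the box lies in the source of its corner-slice chart of `X₃`. [folklore] -/
theorem mem_cornerSliceChart₃_source {p : X} (hp : p ∈ B.box T.D.εw) :
    p ∈ (T.cornerSliceChart₃ p).Θ.source :=
  B.mem_cornerSliceChart_source T.frame₃ T.D.εw_pos T.D.εw_le_δU T.D.εw_le_δV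
    (fun _ hx => T.mem_X₃_iff_of_mem_box hx) (fun x _ => B.mem_surface_iff x) hp

/-- The surface `F` lies in all three sectors. [cite: GayKirby2016, Def. 1] -/
theorem surface_subset_X₂ : B.surface ⊆ T.X₂ := fun x hx => by
  have hb : x ∈ B.box T.D.εw := B.mem_box_of_mem_surface T.D.εw_pos hx
  obtain ⟨hs, hr⟩ := (B.mem_surface_iff x).1 hx
  exact T.mem_X₂_of_wedge₂ hb hr.le (by rw [hs, hr]; simp)

/-- The surface `F` lies in `X₃`. [cite: GayKirby2016, Def. 1] -/
theorem surface_subset_X₃ : B.surface ⊆ T.X₃ := fun x hx => by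
  have hb : x ∈ B.box T.D.εw := B.mem_box_of_mem_surface T.D.εw_pos hx
  obtain ⟨hs, hr⟩ := (B.mem_surface_iff x).1 hx
  exact T.mem_X₃_of_wedge₃ hb hr.ge (by rw [hs, hr]; simp)


/-! ### The `λ`-lemma: near the ascending sheets, points which hit land near the descending
spheres -/

/-- The flow-out of the level for times in `[t₁, t₂]` is compact, hence closed. [folklore] -/
theorem isClosed_image_fl_level (t₁ t₂ : ℝ) :
    IsClosed ((fun p : B.Y × ℝ => B.U.fl (RegularLevel.incl B.hf p.1) p.2) '' (univ ×ˢ Icc t₁ t₂)) := by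
  have hc : Continuous fun p : B.Y × ℝ => B.U.fl (RegularLevel.incl B.hf p.1) p.2 :=
    B.U.continuous_fl.comp (((RegularLevel.isEmbedding_incl B.hf).continuous.comp continuous_fst).prodMk
      continuous_snd)
  exact ((isCompact_univ.prod isCompact_Icc).image hc).isClosed

/-- A point which hits, whose landing point flows above the level `c₁ > f z` within time `T₀`,
and with `a - δ_U/2 < f z`, lies on the flow-out of the level for times in `[-δ_U/2, T₀]`.
[cite: MilnorHCobordism1965, Thm. 3.4 and Thm. 4.1 (PDF p. 22)] -/
theorem mem_image_fl_level (Fr : B.MorseFrame) {z : X} (hz : B.Hit z) {c₁ T₀ : ℝ} (hzc : B.f z < c₁)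
    (hT₀ : c₁ < B.f (B.U.fl (RegularLevel.incl B.hf (B.lamLift z)) T₀)) (hza : B.a - B.U.δ / 2 < B.f z) :
    z ∈ (fun p : B.Y × ℝ => B.U.fl (RegularLevel.incl B.hf p.1) p.2) '' (univ ×ˢ Icc (-(B.U.δ / 2)) T₀) := by
  obtain ⟨τ, hτ⟩ : ∃ τ, B.U.fl (B.lam z) τ = z := mem_range_flow_levelProj B.U.contMDiff B.a z
  rw [← B.incl_lamLift hz] at hτ
  set Yz : X := RegularLevel.incl B.hf (B.lamLift z) with hYz
  have hfY : B.f Yz = B.a := RegularLevel.apply_incl B.hf _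
  have hmono := Fr.monotone_f_fl Yz
  refine ⟨(B.lamLift z, τ), ⟨mem_univ _, ?_, ?_⟩, hτ⟩
  · -- `τ ≥ -δ_U/2`: otherwise `f z ≤ a - δ_U/2` by the clock
    by_contra h
    have hlt : τ < -(B.U.δ / 2) := not_le.1 h
    have hδ := B.U.δ_pos
    have h1 : B.f (B.U.fl Yz τ) ≤ B.f (B.U.fl Yz (-(B.U.δ / 2))) := hmono hlt.le
    have h2 : B.f (B.U.fl Yz (-(B.U.δ / 2))) = B.f Yz + -(B.U.δ / 2) :=
      B.U.apply_fl_eq_add (B.U.mem_band_of_apply_eq hfY)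
        (by rw [hfY]; exact ⟨by linarith, by linarith⟩)
    rw [hfY] at h2
    rw [hτ] at h1
    linarith
  · -- `τ ≤ T₀`: otherwise `f z ≥ f (fl Yz T₀) > c₁`
    by_contra h
    have hlt : T₀ < τ := not_le.1 h
    have h1 : B.f (B.U.fl Yz T₀) ≤ B.f (B.U.fl Yz τ) := hmono hlt.le
    rw [hτ] at h1
    linarith

/-- **The `λ`-lemma.**  If the descending sets of the critical points `q` with `a < f q ≤ c`
meet the level `f = a` inside `{g < b}` (in Lemma 14: the attaching link of the `2`-handles lies
in the interior of the handlebody `H₁₂`) — more generally inside `{g < b'}` —, then near every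
point of the ascending sheets the points which hit the level land in `{g < b'}`.  Proof:
otherwise a point `x` of the sheets is a limit of points `z` which hit with `g (λ z) ≥ b'`; a
cluster point `y*` of their landing points has `g y* ≥ b'`; its forward trajectory converges
to a critical point `q` with
`a < f q`; if `f q > c`, the landing points near `y*` flow above `c` within a bounded time, so
the points `z` lie on the flow-out of the level for a compact set of times, a closed set of
points which hit — and then `x` hits, a contradiction; so `f q ≤ c`, `y*` lies on the
descending set of `q`, and `g y* < b'` by hypothesis: contradiction.
[cite: GayKirby2016, §4, Lemma 14; MilnorHCobordism1965, Def. 3.9 and Thm. 4.1 (PDF p. 22)] -/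
theorem eventually_g_lamLift_lt_of_mem_sheets {b' : ℝ}
    (hL : ∀ q : X, IsMCriticalPt (𝓡 4) B.f q → B.a < B.f q → B.f q ≤ T.c →
      ∀ y : B.Y, RegularLevel.incl B.hf y ∈ stableSet (𝓡 4) B.U.ξ q → B.g y < b')
    {x : X} (hx : x ∈ T.sheets) : ∀ᶠ y in 𝓝 x, B.Hit y → B.g (B.lamLift y) < b' := by
  by_contra hcon
  have hfr : ∃ᶠ y in 𝓝 x, y ∈ {y : X | B.Hit y ∧ b' ≤ B.g (B.lamLift y)} := by
    rw [Filter.not_eventually] at hcon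
    exact hcon.mono fun y hy => ⟨(Classical.not_imp.1 hy).1, not_lt.1 (Classical.not_imp.1 hy).2⟩
  set A : Set X := {y : X | B.Hit y ∧ b' ≤ B.g (B.lamLift y)} with hA
  have hxA : x ∈ closure A := mem_closure_iff_frequently.2 hfr
  haveI : (𝓝[A] x).NeBot := mem_closure_iff_nhdsWithin_neBot.1 hxA
  set F : Filter B.Y := map B.lamLift (𝓝[A] x) with hF
  obtain ⟨ys, hys⟩ := exists_clusterPt_of_compactSpace F
  -- `g ys ≥ b'`
  have hge : b' ≤ B.g ys := by
    have hev : ∀ᶠ y in F, y ∈ {y : B.Y | b' ≤ B.g y} := by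
      rw [hF, eventually_map]
      exact eventually_nhdsWithin_of_forall fun z hz => hz.2
    have hcl : IsClosed {y : B.Y | b' ≤ B.g y} := isClosed_le continuous_const B.hg.contMDiff.continuous
    have hmem : ys ∈ closure {y : B.Y | b' ≤ B.g y} :=
      mem_closure_iff_clusterPt.2 (hys.mono (le_principal_iff.2 hev))
    rw [hcl.closure_eq] at hmem
    exact hmem
  -- the forward limit of `ys`
  set Ys : X := RegularLevel.incl B.hf ys with hYs
  obtain ⟨q, hq, hlim⟩ :=
    IsGradientLike.exists_isMCriticalPt_tendsto_flow_atTop T.Fr.isGradientLike T.Fr.isMorse B.U.contMDiff Ys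
  have hstable : Ys ∈ stableSet (𝓡 4) B.U.ξ q := by
    rw [stableSet_eq_setOf_tendsto B.U.contMDiff]; exact hlim
  have hfYs : B.f Ys = B.a := RegularLevel.apply_incl B.hf ys
  have hmono := T.Fr.monotone_f_fl Ys
  have hflim : Tendsto (fun t => B.f (B.U.fl Ys t)) atTop (𝓝 (B.f q)) :=
    (B.U.contMDiff_f.continuous.tendsto q).comp hlim
  -- `a < f q`
  have haq : B.a < B.f q := by
    have hle : B.a ≤ B.f q := by
      refine ge_of_tendsto hflim (Filter.eventually_atTop.2 ⟨0, fun t ht => ?_⟩)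
      have h := hmono ht
      simp only at h
      rwa [B.U.fl_zero, hfYs] at h
    rcases hle.lt_or_eq with h | h
    · exact h
    · exact absurd hq (B.not_isMCriticalPt_of_apply_eq_a h.symm)
  -- `f q ≤ c`
  have hqc : B.f q ≤ T.c := by
    by_contra hgt
    have hgt : T.c < B.f q := not_le.1 hgt
    obtain ⟨T₀, hT₀⟩ : ∃ T₀ : ℝ, T.c < B.f (B.U.fl Ys T₀) := (hflim.eventually (Ioi_mem_nhds hgt)).exists
    set c₁ : ℝ := (T.c + B.f (B.U.fl Ys T₀)) / 2 with hc₁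
    have hcc₁ : T.c < c₁ := by rw [hc₁]; linarith
    have hc₁m : c₁ < B.f (B.U.fl Ys T₀) := by rw [hc₁]; linarith
    -- the open set `O` of level points flowing above `c₁` within time `T₀`
    have hcontO : Continuous fun y : B.Y => B.f (B.U.fl (RegularLevel.incl B.hf y) T₀) :=
      B.U.contMDiff_f.continuous.comp (B.U.continuous_fl.comp
        ((RegularLevel.isEmbedding_incl B.hf).continuous.prodMk continuous_const))
    have hO : {y : B.Y | c₁ < B.f (B.U.fl (RegularLevel.incl B.hf y) T₀)} ∈ 𝓝 ys :=
      (isOpen_lt continuous_const hcontO).mem_nhds hc₁m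
    -- frequently in `F`, hence frequently near `x` inside `A`, the landing point is in `O`
    have hfrO := hys.frequently hO
    rw [hF, frequently_map] at hfrO
    -- near `x`: `f < c₁` and `a - δ_U/2 < f`
    have hN : ∀ᶠ z in 𝓝[A] x, B.f z < c₁ ∧ B.a - B.U.δ / 2 < B.f z := by
      apply eventually_nhdsWithin_of_eventually_nhds
      have h1 : ∀ᶠ z in 𝓝 x, B.f z < c₁ :=
        (isOpen_lt B.U.contMDiff_f.continuous continuous_const).mem_nhds (hx.2.1.trans_lt hcc₁)
      have h2 : ∀ᶠ z in 𝓝 x, B.a - B.U.δ / 2 < B.f z :=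
        (isOpen_lt continuous_const B.U.contMDiff_f.continuous).mem_nhds
          (by have := B.U.δ_pos; have := hx.1; show B.a - B.U.δ / 2 < B.f x; linarith)
      exact h1.and h2
    have hfrC : ∃ᶠ z in 𝓝[A] x, z ∈ (fun p : B.Y × ℝ => B.U.fl (RegularLevel.incl B.hf p.1) p.2) ''
        (univ ×ˢ Icc (-(B.U.δ / 2)) T₀) := by
      refine (hfrO.and_eventually hN).mp (eventually_nhdsWithin_of_forall fun z hz h => ?_)
      exact mem_image_fl_level T.Fr hz.1 h.2.1 h.1 h.2.2
    -- so `x` lies on this closed set of points which hit: contradiction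
    have hxC := (frequently_nhdsWithin_iff.1 hfrC).mono (fun z hz => hz.1) |>.mem_of_closed
      (isClosed_image_fl_level _ _)
    obtain ⟨⟨y₀, τ₀⟩, -, hy₀⟩ := hxC
    exact hx.2.2 (hy₀ ▸ B.hit_fl (B.hit_of_apply_eq (RegularLevel.apply_incl B.hf y₀)) τ₀)
  -- conclusion
  have hlt := hL q hq haq hqc ys hstable
  linarith

/-- **The `λ`-lemma for the threshold `b - η`, `η > ε`**: near the sheets, points which hit have
`G < -η`, hence `M < 0` below `c` (where `w ≥ ε`, `M = f - c < 0`; where `w < ε`,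
`M ≤ G + σ_ε(ε) = G + ε < 0`). [cite: GayKirby2016, §4, Lemma 14] -/
theorem eventually_M_neg_of_mem_sheets {η : ℝ} (hη : T.ε < η)
    (hL : ∀ q : X, IsMCriticalPt (𝓡 4) B.f q → B.a < B.f q → B.f q ≤ T.c →
      ∀ y : B.Y, RegularLevel.incl B.hf y ∈ stableSet (𝓡 4) B.U.ξ q → B.g y < B.b - η)
    {x : X} (hx : x ∈ T.sheets) : ∀ᶠ y in 𝓝 x, B.Hit y → B.f y < T.c → T.M y < 0 := by
  filter_upwards [T.eventually_g_lamLift_lt_of_mem_sheets hL hx] with y hy h hyc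
  have hG : B.gFun y < -η := by have := hy h; show B.g (B.lamLift y) - B.b < -η; linarith
  rcases le_or_gt T.ε (T.w y) with hw | hw
  · rw [T.M_eq_sub_of_le_w hw]; linarith
  · have hσ : creaseσ T.ε (T.w y) ≤ creaseσ T.ε T.ε := monotone_creaseσ T.ε_pos hw.le
    rw [creaseσ_of_le T.ε_pos le_rfl] at hσ
    show B.gFun y + creaseσ T.ε (T.w y) < 0
    linarith

/-- **Corollary: a point of the sheets below `c` and outside `X₁` is an interior point of
`X₂`, away from `X₃`** — the `2`-handles lie inside `X₂`. [cite: GayKirby2016, §4, Lemma 14] -/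
theorem X₂_mem_nhds_of_mem_sheets {η : ℝ} (hη : T.ε < η)
    (hL : ∀ q : X, IsMCriticalPt (𝓡 4) B.f q → B.a < B.f q → B.f q ≤ T.c →
      ∀ y : B.Y, RegularLevel.incl B.hf y ∈ stableSet (𝓡 4) B.U.ξ q → B.g y < B.b - η)
    {x : X} (hx : x ∈ T.sheets) (hx₁ : x ∉ T.X₁) (hxc : B.f x < T.c) :
    T.X₂ ∈ 𝓝 x ∧ ∀ᶠ y in 𝓝 x, y ∉ T.X₃ := by
  have h1 : ∀ᶠ y in 𝓝 x, y ∉ T.X₁ := T.isClosed_X₁.isOpen_compl.mem_nhds hx₁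
  have h2 : ∀ᶠ y in 𝓝 x, B.f y < T.c := (isOpen_lt B.U.contMDiff_f.continuous continuous_const).mem_nhds hxc
  have h3 := T.eventually_M_neg_of_mem_sheets hη hL hx
  -- the open set where all three hold
  obtain ⟨N, hN, hNo, hxN⟩ := eventually_nhds_iff.1 (h1.and (h2.and h3))
  have hNX₂ : N ⊆ T.X₂ := fun y hy => by
    obtain ⟨hy1, hy2, hy3⟩ := hN y hy
    by_cases hh : B.Hit y
    · exact T.S₂_subset_X₂ ⟨hy1, hy2, hh, hy3 hh hy2⟩
    · exact T.mem_X₂_of_not_hit hy1 hy2.le hh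
  have hNS₃ : ∀ y ∈ N, y ∉ T.S₃ := fun y hy hyS => by
    have := (hN y hy).2.2 hyS.2.1 (hN y hy).2.1
    linarith [hyS.2.2]
  refine ⟨mem_of_superset (hNo.mem_nhds hxN) hNX₂, ?_⟩
  filter_upwards [hNo.mem_nhds hxN] with y hy hy3
  rcases hy3 with hcl | hge
  · -- `y ∈ closure S₃` but `N` is an open set missing `S₃`
    obtain ⟨z, hzN, hzS⟩ := mem_closure_iff_nhds.1 hcl N (hNo.mem_nhds hy)
    exact hNS₃ z hzN hzS
  · exact absurd (hN y hy).2.1 (not_lt.2 hge)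

end TriData

end BiCollar

end Literature.Topology.FourManifolds

end
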